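import Literature.Geometry.Riemannian.TangentCutLocusSubanalytic
import Literature.Geometry.Manifold.DefinableEmbedding
import Literature.ModelTheory.ExponentialFields.RealExpOMinimalOfRealAnExp
import HarnessLib

/-!
# The cut locus is homeomorphic to a compact `ℝ_an,exp`-definable set; Buchner's theorem from the
o-minimal triangulation theorem

Proof file (theorems only) for the named fact
`Literature.Geometry.Riemannian.buchner1977_cutLocus_triangulable` (Buchner 1977: the cut locus of a
compact real-analytic Riemannian manifold is homeomorphic to a finite simplicial complex of dimension
`≤ n - 1`), second road. Buchner's own road (pp. 118–121: `C(p)` is subanalytic, hence triangulable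
by Hironaka 1975) is formalised in `TangentCutLocusSubanalytic.lean` up to Hironaka's image and
triangulation theorems, which the tree does not have. The road taken here replaces them by the
o-minimal structure `ℝ_an,exp` (van den Dries–Miller 1994; Pila 2022, 8.21–8.26):

1. `TCL(p) ⊆ T_pM` is bounded subanalytic (`isSubanalytic_tangentCutLocus`, Hironaka's Def. 3.3
   alone), hence `ℝ_an,exp`-definable (`IsSubanalytic.definable_realAnExp`, the elementary half of
   "globally subanalytic = `ℝ_an`-definable");
2. `C(p) = exp_p(TCL(p))` with `exp_p` real-analytic (`contMDiff_riemannianExpMap_omega`), `C(p)`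
   closed; by `exists_definable_homeomorph_of_eq_image` (a topological embedding `F : M → ℝᴺ` built
   from finitely many analytic charts and semialgebraic bumps, under which `F(exp_p(TCL(p)))` has a
   first-order description) `C(p)` is homeomorphic to a COMPACT `ℝ_an,exp`-DEFINABLE `X ⊆ ℝᴺ`
   (`exists_definable_homeomorph_cutLocus`);
3. a compact set definable in an o-minimal expansion of the real field is homeomorphic to the
   polyhedron of a finite simplicial complex — van den Dries 1998, Ch. 8, (2.9) Triangulation
   Theorem (hypothesis `hT` below: the tree has van den Dries' Ch. 8 proof only for the o-minimal
   structure of semialgebraic sets, `semialgebraic_triangulation`), applied to `ℝ_an,exp`, which is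
   o-minimal by the tree's named fact `VandendriesMiller1994_realAnExp_isOMinimal`;
4. the dimension clause and the Euclidean carrier are theorems of the tree
   (`buchner1977_cutLocus_triangulable_of_homeomorph_pi`: `C(p)` has empty interior, invariance of
   domain).

## Main statements (all proved)

* `exists_definable_homeomorph_cutLocus` — `C(p) ≃ₜ X` with `X ⊆ ℝᴺ` compact and
  `ℝ_an,exp`-definable.
* `buchner1977_cutLocus_triangulable_of_realAnExp_triangulation` — Buchner's theorem from the
  triangulability of compact `ℝ_an,exp`-definable subsets of `ℝᴺ`.
* `buchner1977_cutLocus_triangulable_of_isOMinimal` — Buchner's theorem from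
  `VandendriesMiller1994_realAnExp_isOMinimal` and the o-minimal triangulation theorem
  (van den Dries 1998, Ch. 8 (2.9), for o-minimal expansions of the real field, compact case).

## References

* [Buchner1977Simplicial] M. A. Buchner, Simplicial structure of the real analytic cut locus,
  Proc. AMS 64 (1977), 118–121.
* [Dries1998] L. van den Dries, *Tame topology and o-minimal structures* (1998), Ch. 8 (1.7), (2.3),
  (2.9) (read: held copy, pp. 122, 127, 130).
* [VandendriesMiller1994] L. van den Dries, C. Miller, Israel J. Math. 85 (1994), 19–56.
* [Pila2022] J. Pila, *Point-counting and the Zilber–Pink conjecture* (2022), 8.21, Thm. 8.26.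
-/

noncomputable section

open Bundle Set Function Filter Metric FirstOrder
open scoped Manifold ContDiff Topology

namespace Literature.Geometry.Riemannian

open Literature.Geometry.Lorentzian
open Literature.Geometry.Lorentzian.PseudoRiemannianMetric
open Literature.Geometry.Manifold
open Literature.ModelTheory.ExponentialFields

universe u v w

section CutLocus

variable {E : Type*} [NormedAddCommGroup E] [NormedSpace ℝ E] [FiniteDimensional ℝ E]
  {H : Type*} [TopologicalSpace H] {I : ModelWithCorners ℝ E H} [I.Boundaryless]
  {M : Type*} [TopologicalSpace M] [ChartedSpace H M] [IsManifold I ω M]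
  [CompactSpace M] [T2Space M] [ConnectedSpace M]

/-- **The cut locus of a point of a compact real-analytic Riemannian manifold is homeomorphic to a
compact `ℝ_an,exp`-definable subset of some `ℝᴺ`**: `C(p) = exp_p(TCL(p))` with `exp_p` analytic
and `TCL(p)` bounded subanalytic, and `C(p)` is closed; apply
`exists_definable_homeomorph_of_eq_image`. [cite: Buchner1977Simplicial, pp. 118–121] -/
theorem exists_definable_homeomorph_cutLocus
    (g : PseudoRiemannianMetric I ω E (TangentSpace I : M → Type _)) (hg : g.IsRiemannian) (p : M) :
    ∃ (N : ℕ) (X : Set (Fin N → ℝ)), IsCompact X ∧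
      (univ : Set ℝ).Definable Language.realAnExp X ∧ Nonempty (cutLocus g hg p ≃ₜ X) := by
  haveI : CompleteSpace E := FiniteDimensional.complete ℝ E
  haveI : Fact (1 ≤ (ω : ℕ∞ω)) := ⟨le_top⟩
  haveI : g.HasLeviCivita := g.hasLeviCivita
  haveI : CovariantDerivative.ContMDiffCovariantDerivative g.leviCivita 1 :=
    ⟨g.isLocallyContMDiff_leviCivita_holds 1 le_top univ isOpen_univ⟩
  have hc : IsGeodesicallyComplete g.leviCivita :=
    g.isGeodesicallyComplete_of_compactSpace (le_top : (2 : ℕ∞ω) ≤ ω) hg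
  exact exists_definable_homeomorph_of_eq_image I
    (ex := fun v : E => expMap g.leviCivita p (show TangentSpace I p from v))
    (contMDiff_riemannianExpMap_omega g hc p) (isSubanalytic_tangentCutLocus g hg p)
    (isBounded_tangentCutLocus g hg p) (isClosed_cutLocus_of_compactSpace g le_top hg p)
    (cutLocus_eq_image_tangentCutLocus g hg p)

end CutLocus

/-! ## Buchner's theorem from the o-minimal triangulation theorem -/

section Reduction

/-- **Buchner 1977 from the triangulability of compact `ℝ_an,exp`-definable sets.** If every compact
`ℝ_an,exp`-definable subset of every `ℝᴺ` is homeomorphic to the polyhedron of a finite simplicial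
complex (van den Dries 1998, Ch. 8 (2.9)/(1.7) for the o-minimal structure `ℝ_an,exp`), then the cut
locus of every point of every compact real-analytic Riemannian manifold is homeomorphic to a finite
simplicial complex of dimension `≤ n - 1` in a Euclidean space.
[cite: Buchner1977Simplicial, pp. 118–121] -/
theorem buchner1977_cutLocus_triangulable_of_realAnExp_triangulation
    (hT : ∀ (N : ℕ) (X : Set (Fin N → ℝ)), (univ : Set ℝ).Definable Language.realAnExp X →
      IsCompact X → ∃ (n : ℕ) (K : Geometry.SimplicialComplex ℝ (Fin n → ℝ)),
        K.faces.Finite ∧ Nonempty (X ≃ₜ K.space)) :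
    buchner1977_cutLocus_triangulable.{u, v, w} := by
  refine buchner1977_cutLocus_triangulable_of_homeomorph_pi ?_
  intro E _ _ _ H _ I _ M _ _ _ _ _ _ g hg p
  obtain ⟨N, X, hXc, hXd, ⟨φ⟩⟩ := exists_definable_homeomorph_cutLocus g hg p
  obtain ⟨n, K, hK, ⟨ψ⟩⟩ := hT N X hXd hXc
  exact ⟨n, K, hK, ⟨φ.trans ψ⟩⟩

/-- **Buchner 1977 from the o-minimality of `ℝ_an,exp` and the o-minimal triangulation theorem.**
Hypotheses: (O) `VandendriesMiller1994_realAnExp_isOMinimal` — the tree's named fact that `ℝ_an,exp`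
is o-minimal (van den Dries–Miller 1994; Pila 2022, Thm. 8.26); (T) van den Dries 1998, Ch. 8,
(2.9) with (2.3), (1.7), compact case, over `ℝ`: in every o-minimal expansion of the ordered field of
real numbers — a first-order language `L` on `ℝ` expanding `Language.orderedRing` along
`φ : Language.orderedRing →ᴸ L` (the convention of the tree's o-minimal files, e.g.
`definableChoice`) with `L.IsOMinimal ℝ` — every compact definable `X ⊆ ℝᴺ` is homeomorphic to the
polyhedron of a finite simplicial complex. (T) is NOT in the tree in this generality (its Ch. 8 proof
is carried out there for semialgebraic sets only, `semialgebraic_triangulation`); `ℝ_an,exp` expands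
the ordered ring along `Language.orderedExpRing.toRealAnExp ∘ orderedRingHomOrderedExpRing`.
[cite: Buchner1977Simplicial, pp. 118–121] -/
theorem buchner1977_cutLocus_triangulable_of_isOMinimal
    (hO : VandendriesMiller1994_realAnExp_isOMinimal)
    (hT : ∀ (L : FirstOrder.Language.{0, 0}) [L.Structure ℝ] (φ : Language.orderedRing →ᴸ L)
      [φ.IsExpansionOn ℝ], L.IsOMinimal ℝ →
        ∀ (N : ℕ) (X : Set (Fin N → ℝ)), (univ : Set ℝ).Definable L X → IsCompact X →
          ∃ (n : ℕ) (K : Geometry.SimplicialComplex ℝ (Fin n → ℝ)),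
            K.faces.Finite ∧ Nonempty (X ≃ₜ K.space)) :
    buchner1977_cutLocus_triangulable.{u, v, w} := by
  refine buchner1977_cutLocus_triangulable_of_realAnExp_triangulation.{u, v, w}
    fun N X hX hXc => ?_
  -- `ℝ_an,exp` expands the ordered ring: compose the two expansions of the tree
  haveI : (Language.orderedExpRing.toRealAnExp.comp orderedRingHomOrderedExpRing).IsExpansionOn ℝ :=
    { map_onFunction := fun f x => by
        show FirstOrder.Language.Structure.funMap (Language.orderedExpRing.toRealAnExp.onFunction
          (orderedRingHomOrderedExpRing.onFunction f)) x = _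
        rw [FirstOrder.Language.LHom.map_onFunction, FirstOrder.Language.LHom.map_onFunction]
      map_onRelation := fun R x => by
        show FirstOrder.Language.Structure.RelMap (Language.orderedExpRing.toRealAnExp.onRelation
          (orderedRingHomOrderedExpRing.onRelation R)) x = _
        rw [FirstOrder.Language.LHom.map_onRelation, FirstOrder.Language.LHom.map_onRelation] }
  exact hT Language.realAnExp (Language.orderedExpRing.toRealAnExp.comp orderedRingHomOrderedExpRing)
    hO N X hX hXc

end Reduction

end Literature.Geometry.Riemannian
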